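import Summits.MatrixMultiplication.MatrixMultiplication.Theorems.AbelianSTPPCensusTALin1700Data3

/-!
# T_A/1700 certificate: kernel evaluation, volumes `1220 … 1319`

Cell mm-stpp (rung F-M1), T_A/1700 = «no abelian STPP host of order `≤ 1700` beats `τ = 2.371`»; checker in `AbelianSTPPCensusTALin1700Defs.lean`,
checkpoint states in `…TALin1700Data1/2/3.lean`.  `decide` with kernel reduction (standard axioms; no `native_decide`); at most `150` sorted
candidate shapes per segment (× 500 orders) and `Elab.async false` — the safe size at the gate (cf. the T_A/1200 chain).  Each segment
recomputes the next checkpoint from the previous one and checks every sorted candidate shape of its volumes at every order `1201 … 1700`; consumed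
by `TALin1700.seg_sound` / `TALin1700.loopL_sound` in `AbelianSTPPCensusLeafTA1700Closed.lean`.
WHAT THIS IS NOT: arithmetic on shape lists only; no statement about STPP families or `ω`.
-/

set_option linter.dupNamespace false
set_option autoImplicit false
set_option Elab.async false

namespace Summit.MatrixMultiplication.MatrixMultiplication.Theorems.TALin1700

set_option maxHeartbeats 0 in
/-- Segment `1220 … 1247` (148 sorted shapes): from `st1219` the loop reaches `st1247`, all checks at orders `1201 … 1700` passing. [original] -/
theorem sg1220 : loopL 1201 500 28 1220 st1219 = (true, st1247) := by decide +kernel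

set_option maxHeartbeats 0 in
/-- Segment `1248 … 1271` (147 sorted shapes): from `st1247` the loop reaches `st1271`, all checks at orders `1201 … 1700` passing. [original] -/
theorem sg1248 : loopL 1201 500 24 1248 st1247 = (true, st1271) := by decide +kernel

set_option maxHeartbeats 0 in
/-- Segment `1272 … 1295` (126 sorted shapes): from `st1271` the loop reaches `st1295`, all checks at orders `1201 … 1700` passing. [original] -/
theorem sg1272 : loopL 1201 500 24 1272 st1271 = (true, st1295) := by decide +kernel

set_option maxHeartbeats 0 in
/-- Segment `1296 … 1319` (127 sorted shapes): from `st1295` the loop reaches `st1319`, all checks at orders `1201 … 1700` passing. [original] -/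
theorem sg1296 : loopL 1201 500 24 1296 st1295 = (true, st1319) := by decide +kernel

end Summit.MatrixMultiplication.MatrixMultiplication.Theorems.TALin1700
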